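import Summits.HodgeConjecture.HodgeConjecture.Theorems.F0P3KitOfRecord               -- ★ p822184 (K0, p04 (g7)): `kitOfRecord`, `GHSide`, `XiSide`, `cptXi₀` (+ ★ `unitaryLoc₀`, `IsCohUnitaryClass`, ★ K6 `archPacketOfRecord`)
import Summits.HodgeConjecture.HodgeConjecture.Theorems.F0P3ClassificationLawsV6       -- ★ p822130 (V6-B, p03 (g6)): law `UnitaryPacket`
import HarnessLib

/-!
# Crux `H413` — K8 glue (h10): **law `UnitaryPacket` AT THE KIT OF RECORD `𝔠₀`** — a THEOREM modulo the unitarity of the local packet members (F0P3b desk, T3∕T6)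

PLAN.F0P3g5 §5 K7∕K8, RULING (V42) (F0P3-plan (g5), 2026-08-31) and this desk's memo `SPECPKG-XI-ROWS.F0P3b-plan-g7.md`: hypothesis `h10` of ★ `laws_kitOfRecord_of₂`
(`F0P3KitOfRecordClosed`), the V6-B law `UnitaryPacket` («coordinates with a non-zero coefficient in (14.6.3) are unitary»), reads at `𝔠₀ = kitOfRecord …` NO witnessed
socket: `𝔠₀.expansion ξ S x` is built from tokens OF RECORD only — `cptXi₀`, `nCompactOfRecord`, the archimedean packet ★ `archPacketOfRecord ι μω jInf dsInf` (K6) and the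
finite family `ξd.packFin` — and `𝔠₀.UnitaryLoc = unitaryLoc₀`.  So `h10` is not a letter but GLUE from three unitarity inputs:
* `hFinU` — the members `πⁿ(ξ_v)`, `πˢ(ξ_v)` of the finite local packets of record are unitarizable [Rogawski1990 §12.2 (2) p. 174 (`πⁿ`), Prop. 13.1.3 (d) p. 199 (`πˢ`
  supercuspidal); split `v`: `i_G(ξ_v ⊗ μ_w ∘ det₀)` §13.3 p. 201] — a hypothesis on the closer's `ξd.packFin` (p01's ★ `xiPacketFamilyOfRecord`);
* `hJU`, `hDU` — the POSITED archimedean classes `jInf p q t` (`[J^±_φ]`) and `dsInf p q t` (`[D^∓_φ] ∕ [π²_φ]`) are classes of unitary modules with cohomology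
  [Rogawski1990 §12.3 p. 178] (R-22′-style hypotheses, discharged when T6 constructs the classes); on the cohomological locus `πⁿ = archDegOneClass ±1` is unitary
  UNCONDITIONALLY (★ `isCohUnitaryClass_archDegOneClass`, `F0P3UnitaryLocOfRecord`).
Contents: §1 kit-parametric lemmas over ★ V6-A `ClassificationKit` (`eq_or_eq_of_memberCoeff_ne_zero`, `exists_memberCoeff_ne_zero_of_expansion_ne_zero`); §2 the two
member-unitarity lemmas; §3 **`unitaryPacket_kitOfRecord_of hFinU hJU hDU : (kitOfRecord …).UnitaryPacket`**.  Theorems only; no `sorry`, no named fact, no instance, no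
notation.  `--supports stmt-HodgeConjecture-24833 --as helper`.  HONEST LABEL: HC_CM is proved only modulo the printed citations until rung 0 closes.
-/

set_option autoImplicit false

noncomputable section

open NumberField IsDedekindDomain MeasureTheory
open Literature.NumberTheory.Rogawski1990 Literature.NumberTheory.GaloisRepresentations
open Literature.NumberTheory.Automorphic Literature.NumberTheory.Automorphic.UnitaryGroup
open Literature.RepresentationTheory.BorelWallach2000 Literature.RepresentationTheory.KonnoKonno2007
open scoped Matrix ComplexOrder BigOperators Classical

namespace Summit.HodgeConjecture.HodgeConjecture.Cruxes.H413.F0P3bUnitaryPacketAtKitOfRecord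

open Summit.HodgeConjecture.HodgeConjecture.Cruxes.H413.F0P3InnerFormClassificationV6
open Summit.HodgeConjecture.HodgeConjecture.Cruxes.H413.F0P3InnerFormClassificationV6.ClassificationKit (memberCoeff)
open Summit.HodgeConjecture.HodgeConjecture.Cruxes.H413.F0P3XiArchPacketOfRecord (archPacketOfRecord archPacketAt archPacketAt_πn_of archPacketAt_πn_of_not)
open Summit.HodgeConjecture.HodgeConjecture.Cruxes.H413.F0P3UnitaryLocOfRecord (unitaryLoc₀ IsCohUnitaryClass isCohUnitaryClass_archDegOneClass)
open Summit.HodgeConjecture.HodgeConjecture.Cruxes.H413.F0P3KitOfRecord (GHSide XiSide cptXi₀ kitOfRecord)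

variable (L : Type) [Field L] [NumberField L] [IsCMField L] (H : Matrix (Fin 3) (Fin 3) L) (ι : L →+* ℂ) (T : GL (Fin 3) ℂ)
  (hT : (T : Matrix (Fin 3) (Fin 3) ℂ)ᴴ * H.map ι * (T : Matrix (Fin 3) (Fin 3) ℂ) = Literature.Geometry.ComplexHyperbolic.BallModel.J)
  (μ : Measure (Gp L H).automorphicQuotient) [(Gp L H).IsAutomorphicMeasure μ]

/-! ## §1 Kit-parametric lemmas: a non-zero coefficient in (14.6.3) sits at packet members -/

section KitParametric

variable {L H ι T hT μ}

/-- A non-zero member coefficient occurs only at `πⁿ` or at `πˢ`. [cite: Rogawski1990, §14.6 p. 238 ll. 11–18] -/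
theorem eq_or_eq_of_memberCoeff_ne_zero {C : Type*} (Pk : LocalAPacket C) (ε : ℚ) (x : C) (h : memberCoeff Pk ε x ≠ 0) :
    x = Pk.πn ∨ Pk.πs = some x := by
  unfold ClassificationKit.memberCoeff at h
  split_ifs at h with h1 h2
  · exact Or.inl h1
  · exact Or.inr h2
  · exact absurd rfl h

/-- If the coefficient `E_ξ(x)` of (14.6.3) is non-zero, then for one sign `ε` every local member coefficient of `x` is non-zero (the archimedean one at `ι` and the
finite ones at `v ∈ S`). [cite: Rogawski1990, §14.6 p. 238 ll. 11–18; p. 244 ll. 6–17] -/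
theorem exists_memberCoeff_ne_zero_of_expansion_ne_zero (𝔠 : ClassificationKit L H ι T hT μ) (ξ : OneDimAutRepH L) (S : Finset (Places L)) (x : LocS L H S)
    (h : 𝔠.expansion ξ S x ≠ 0) :
    ∃ ε : ℚ, memberCoeff (𝔠.packInf ξ) ε x.1 ≠ 0 ∧ ∀ v : ↥S, memberCoeff (𝔠.packFin ξ v.1) ε (x.2 v) ≠ 0 := by
  by_contra hcon
  push Not at hcon
  apply h
  have hz : ∀ ε : ℚ, memberCoeff (𝔠.packInf ξ) ε x.1 * ∏ v : ↥S, memberCoeff (𝔠.packFin ξ v.1) ε (x.2 v) = 0 := by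
    intro ε
    by_cases h0 : memberCoeff (𝔠.packInf ξ) ε x.1 = 0
    · rw [h0, zero_mul]
    · obtain ⟨v, hv⟩ := hcon ε h0
      rw [Finset.prod_eq_zero (Finset.mem_univ v) hv, mul_zero]
  unfold ClassificationKit.expansion
  rw [hz (-1), hz 1]
  simp

/-- Hence the coordinates of `x` are MEMBERS of the local packets: `x_ι ∈ {πⁿ_ι, πˢ_ι}` and `x_v ∈ {πⁿ_v, πˢ_v}` for `v ∈ S`. [cite: Rogawski1990, §14.6 p. 238 ll. 11–18] -/
theorem mem_of_expansion_ne_zero (𝔠 : ClassificationKit L H ι T hT μ) (ξ : OneDimAutRepH L) (S : Finset (Places L)) (x : LocS L H S)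
    (h : 𝔠.expansion ξ S x ≠ 0) :
    (x.1 = (𝔠.packInf ξ).πn ∨ (𝔠.packInf ξ).πs = some x.1) ∧ ∀ v : ↥S, x.2 v = (𝔠.packFin ξ v.1).πn ∨ (𝔠.packFin ξ v.1).πs = some (x.2 v) := by
  obtain ⟨ε, h1, h2⟩ := exists_memberCoeff_ne_zero_of_expansion_ne_zero 𝔠 ξ S x h
  exact ⟨eq_or_eq_of_memberCoeff_ne_zero _ ε _ h1, fun v => eq_or_eq_of_memberCoeff_ne_zero _ ε _ (h2 v)⟩

end KitParametric

/-! ## §2 Unitarity of the members of the packets of record -/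

section Members

variable {L H}

/-- **Archimedean members are unitary with cohomology**: on the cohomological locus `πⁿ = archDegOneClass ±1` (★ `isCohUnitaryClass_archDegOneClass`, unconditional); off it
`πⁿ = jInf p q t` and always `πˢ = dsInf p q t` — the posited classes, unitary by hypothesis. [cite: Rogawski1990, §12.3 p. 178] -/
theorem isCohUnitaryClass_of_mem_archPacketAt (jInf dsInf : ℤ → ℤ → ℤ → Cinf)
    (hJU : ∀ p q t : ℤ, IsCohUnitaryClass (jInf p q t)) (hDU : ∀ p q t : ℤ, IsCohUnitaryClass (dsInf p q t)) (p q t : ℤ) (y : Cinf)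
    (h : y = (archPacketAt jInf dsInf p q t).πn ∨ (archPacketAt jInf dsInf p q t).πs = some y) : IsCohUnitaryClass y := by
  rcases h with h | h
  · by_cases hc : ArchSignRecipe.IsCohTrivial p q t
    · rw [h, archPacketAt_πn_of jInf dsInf hc]
      exact isCohUnitaryClass_archDegOneClass _ _
    · rw [h, archPacketAt_πn_of_not jInf dsInf hc]
      exact hJU p q t
  · have h' : some (dsInf p q t) = some y := h
    rw [← Option.some.inj h']
    exact hDU p q t

/-- **Finite members are unitarizable** under the unitarity hypothesis on the packet. [cite: Rogawski1990, §12.2 p. 174; §13.1 Prop. 13.1.3 (d) p. 199] -/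
theorem isUnitarizable_of_mem {v : Places L} (Pk : CMLocalAPacket L H v)
    (hP : Pk.πn.IsUnitarizable ∧ ∀ s, Pk.πs = some s → s.IsUnitarizable) (z : IrrClass ((cmDatum L 3 H).Local v))
    (h : z = Pk.πn ∨ Pk.πs = some z) : z.IsUnitarizable := by
  rcases h with h | h
  · rw [h]; exact hP.1
  · exact hP.2 z h

end Members

/-! ## §3 Law `UnitaryPacket` at `𝔠₀` -/

section AtKitOfRecord

variable [MeasurableSpace (Gp L H).Adelic] [BorelSpace (Gp L H).Adelic]
variable (𝔰 : Sockets L H μ) (gh : GHSide L H ι T hT 𝔰.PacketG 𝔰.PacketH) (ξd : XiSide L H 𝔰.PacketG 𝔰.PacketH)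
  (μω : HeckeCharacter L) (c : ℚ) (jInf dsInf : ℤ → ℤ → ℤ → Cinf)
  (archTr : Cinf → (UnitaryGroup.arch (↥(maximalRealSubfield L)) L (IsCMField.complexConj L) 3 H → ℂ) → ℂ)
  (ν : Measure (Gp L H).Adelic) [IsFiniteMeasureOnCompacts ν]
  (μv : ∀ v : Places L, @Measure ((cmDatum L 3 H).Local v) (borel _))
  (ramCls₀ : DiscreteAutomorphicRep (Gp L H) μ → Set (Places L))

/-- **LAW `UnitaryPacket` AT THE KIT OF RECORD** (hypothesis `h10` of ★ `laws_kitOfRecord_of₂`): if the members of the finite local packets of record are unitarizable and the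
posited archimedean classes `jInf`, `dsInf` are classes of unitary modules with cohomology, then every coordinate with a non-zero coefficient in (14.6.3) is unitary.
[cite: Rogawski1990, §12.2 p. 174; §12.3 p. 178; §13.1 Prop. 13.1.3 (d) p. 199; §14.6 p. 244 ll. 6–17] -/
theorem unitaryPacket_kitOfRecord_of
    (hFinU : ∀ (ξ : OneDimAutRepH L) (v : Places L),
      ((ξd.packFin ξ v).πn).IsUnitarizable ∧ ∀ s, (ξd.packFin ξ v).πs = some s → s.IsUnitarizable)
    (hJU : ∀ p q t : ℤ, IsCohUnitaryClass (jInf p q t)) (hDU : ∀ p q t : ℤ, IsCohUnitaryClass (dsInf p q t)) :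
    (kitOfRecord L H ι T hT μ 𝔰 gh ξd μω c jInf dsInf archTr ν μv ramCls₀).UnitaryPacket := by
  intro ξ S x _ hne
  obtain ⟨h1, h2⟩ := mem_of_expansion_ne_zero _ ξ S x hne
  show IsCohUnitaryClass x.1 ∧ ∀ v : ↥S, (x.2 v).IsUnitarizable
  exact ⟨isCohUnitaryClass_of_mem_archPacketAt jInf dsInf hJU hDU _ _ _ x.1 h1, fun v => isUnitarizable_of_mem (ξd.packFin ξ v.1) (hFinU ξ v.1) (x.2 v) (h2 v)⟩

end AtKitOfRecord

end Summit.HodgeConjecture.HodgeConjecture.Cruxes.H413.F0P3bUnitaryPacketAtKitOfRecord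

end
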